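import Summits.HubbardSuperconductivity.HubbardSuperconductivity.Theorems.AnisotropyChordTransferFibre3RingShift

/-!
# Route `AnisotropyChord` / H0 rotor rung: the diagonal row sums of the torus kernel at `λ = 0` — the inner ring sums within `1/(2 sin²u)` of `L/(4|sin u|)`, and the odd sine sums `= cot`

Toolkit for `…Fibre3DiagonalValues` (the DIAGONAL VALUES `a_∞(n,n) = (1/π)Σ_{k<n} 1/(2k+1)` of the ℤ² kernel, the
«transcendental inputs» `1/π, 4/(3π), 23/(15π)` of p2 g2's `…Fibre3ZSquareKernel`).  p3's `diag_rotation` (every `L`, every `λ`)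
writes `2V·a_L(n,n;0) = Σ_{p<2L} (1 − cos(2πnp/L))·S_p`, `S_p = Σ_{j<L} 1/(4 − 4cos(πp/L)cos(π(2j + p mod 2)/L))`.  Here:
* hyperbolic: `sinh_div_cosh_sub_one` (`sinh x/(cosh x − 1) − 1 = 2/(eˣ − 1)`), `abs_sinh_div_cosh_sub_pow_sub_one`
  (`|sinh x/(cosh x − (−1)^τ) − 1| ≤ 2/(eˣ − 1)`, `x > 0`);
* `sum_range_eq_sum_zmod` (`Σ_{j<L} f j = Σ_{j : ZMod L} f j.val`);
* ★ `inner_sum_closed`: for `0 < c < 1`, `Σ_{j<L} 1/(4 − 4c·cos(π(2j+τ)/L)) = L/(4s)·sinh(Lμ)/(cosh(Lμ) − (−1)^τ)` with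
  `s = √(1−c²)`, `μ = log((1+s)/c)` (`cosh μ = 1/c`, `sinh μ = s/c`; p3's `ringResolventSumShift_holds`);
* ★★ `inner_sum_bound`: for `0 ≤ c < 1`, **`|Σ_{j<L} 1/(4 − 4c·cos(π(2j+τ)/L)) − L/(4√(1−c²))| ≤ 1/(2(1−c²))`**
  (`e^{Lμ} = ((1+s)/c)^L ≥ (1+s)^L ≥ 1 + Ls`, so the hyperbolic correction is `≤ 2/(Ls)`);
* trigonometric: `two_sin_mul_sum_sin_odd` (`2 sin u·Σ_{k<n} sin((2k+1)u) = 1 − cos(2nu)`), `two_sin_half_mul_sum_sin`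
  (`2 sin(θ/2)·Σ_{p<L} sin(pθ) = cos(θ/2) − cos(Lθ − θ/2)`), ★ `sum_sin_odd_eq_cot`
  (`Σ_{p<L} sin(p(2k+1)π/L) = cos(θ)/sin(θ)`, `θ = (2k+1)π/(2L)`, `2k+1 < 2L`), `abs_theta_cot_sub_one_le` (`|θ·cos θ/sin θ − 1| ≤ θ²/2`).
Prover seat `hubbard-h0-rotor-p1` g25; helper for stmt-HubbardSuperconductivity-19089 (`--supports`).
WHAT THIS IS NOT: nothing here proves superconductivity in the Hubbard model (rotor TARGET as worded stays FALSE, g15);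
elementary sums serving ONE input (the ℤ² skeleton values) of ONE input (HOLE₂) of ONE conditional reduction (rung 19089).
Mathlib + tree imports only; no sorry, no axioms.
-/

set_option linter.dupNamespace false
set_option autoImplicit false

noncomputable section

open scoped BigOperators
open Complex

namespace Summit.HubbardSuperconductivity.HubbardSuperconductivity.Theorems.AnisotropyChord.Transfer.Fibre3

variable (L : ℕ) [NeZero L]

/-! ## Hyperbolic corrections -/

omit [NeZero L] in
/-- `sinh x/(cosh x − 1) − 1 = 2/(eˣ − 1)` (`x ≠ 0`). [folklore] -/
theorem sinh_div_cosh_sub_one {x : ℝ} (hx : x ≠ 0) :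
    Real.sinh x / (Real.cosh x - 1) - 1 = 2 / (Real.exp x - 1) := by
  set E := Real.exp x with hE
  have hE0 : 0 < E := Real.exp_pos x
  have hE1 : E ≠ 1 := by rw [hE]; exact fun h => hx (by simpa using h)
  have h1 : E - 1 ≠ 0 := sub_ne_zero.mpr hE1
  have hs : Real.sinh x = (E - 1) * (E + 1) / (2 * E) := by
    rw [Real.sinh_eq, Real.exp_neg, ← hE]; field_simp; ring
  have hc : Real.cosh x - 1 = (E - 1) ^ 2 / (2 * E) := by
    rw [Real.cosh_eq, Real.exp_neg, ← hE]; field_simp; ring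
  rw [hc, hs, div_div_div_cancel_right₀ (by positivity : (2 : ℝ) * E ≠ 0)]
  rw [sq, mul_div_mul_left _ _ h1, div_sub_one h1, div_left_inj' h1]
  ring

omit [NeZero L] in
/-- `1 − sinh x/(cosh x + 1) = 2/(eˣ + 1)`. [folklore] -/
theorem one_sub_sinh_div_cosh_add_one (x : ℝ) :
    1 - Real.sinh x / (Real.cosh x + 1) = 2 / (Real.exp x + 1) := by
  set E := Real.exp x with hE
  have hE0 : 0 < E := Real.exp_pos x
  have h1 : E + 1 ≠ 0 := by positivity
  have hs : Real.sinh x = (E - 1) * (E + 1) / (2 * E) := by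
    rw [Real.sinh_eq, Real.exp_neg, ← hE]; field_simp; ring
  have hc : Real.cosh x + 1 = (E + 1) ^ 2 / (2 * E) := by
    rw [Real.cosh_eq, Real.exp_neg, ← hE]; field_simp; ring
  rw [hc, hs, div_div_div_cancel_right₀ (by positivity : (2 : ℝ) * E ≠ 0)]
  rw [sq, mul_div_mul_right _ _ h1, one_sub_div h1, div_left_inj' h1]
  ring

omit [NeZero L] in
/-- ★ `|sinh x/(cosh x − (−1)^τ) − 1| ≤ 2/(eˣ − 1)` for `x > 0`. [folklore] -/
theorem abs_sinh_div_cosh_sub_pow_sub_one {x : ℝ} (hx : 0 < x) (τ : ℕ) :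
    |Real.sinh x / (Real.cosh x - (-1) ^ τ) - 1| ≤ 2 / (Real.exp x - 1) := by
  have hE1 : 1 < Real.exp x := Real.one_lt_exp_iff.mpr hx
  have hpos : 0 < 2 / (Real.exp x - 1) := by
    apply div_pos (by norm_num); linarith
  rcases neg_one_pow_eq_or ℝ τ with h | h
  · rw [h, sinh_div_cosh_sub_one hx.ne', abs_of_pos hpos]
  · rw [h, sub_neg_eq_add]
    have e : Real.sinh x / (Real.cosh x + 1) - 1 = -(2 / (Real.exp x + 1)) := by
      rw [← one_sub_sinh_div_cosh_add_one x]; ring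
    rw [e, abs_neg, abs_of_pos (by positivity)]
    apply div_le_div_of_nonneg_left (by norm_num) (by linarith) (by linarith)

/-! ## The inner ring sums in closed form -/

/-- `Σ_{j<L} f j = Σ_{j : ZMod L} f j.val`. [folklore] -/
theorem sum_range_eq_sum_zmod (f : ℕ → ℝ) : ∑ j ∈ Finset.range L, f j = ∑ j : ZMod L, f j.val := by
  obtain ⟨k, hk⟩ : ∃ k, L = k + 1 := ⟨L - 1, by have := Nat.pos_of_ne_zero (NeZero.ne L); omega⟩
  subst hk
  rw [← Fin.sum_univ_eq_sum_range]
  rfl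

/-- ★ the inner ring sum in closed form: for `0 < c < 1` and any `τ : ℕ`,
`Σ_{j<L} 1/(4 − 4c·cos(π(2j+τ)/L)) = L/(4s) · sinh(Lμ)/(cosh(Lμ) − (−1)^τ)`, `s = √(1−c²)`, `μ = log((1+s)/c)`. [folklore] -/
theorem inner_sum_closed {c : ℝ} (hc0 : 0 < c) (hc1 : c < 1) (τ : ℕ) :
    ∑ j ∈ Finset.range L, 1 / (4 - 4 * c * Real.cos (Real.pi * ((2 * j + τ : ℕ) : ℝ) / L))
      = L / (4 * Real.sqrt (1 - c ^ 2))
        * (Real.sinh (L * Real.log ((1 + Real.sqrt (1 - c ^ 2)) / c))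
          / (Real.cosh (L * Real.log ((1 + Real.sqrt (1 - c ^ 2)) / c)) - (-1) ^ τ)) := by
  have hL0 : (0 : ℝ) < L := by exact_mod_cast Nat.pos_of_ne_zero (NeZero.ne L)
  set s : ℝ := Real.sqrt (1 - c ^ 2) with hs
  have h1c : 0 < 1 - c ^ 2 := by nlinarith
  have hs0 : 0 < s := Real.sqrt_pos.mpr h1c
  have hs2 : s ^ 2 = 1 - c ^ 2 := Real.sq_sqrt h1c.le
  set t : ℝ := (1 + s) / c with ht
  have ht1 : 1 < t := by
    rw [ht, lt_div_iff₀ hc0]; linarith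
  have ht0 : 0 < t := by linarith
  set μ : ℝ := Real.log t with hμ
  have hμ0 : 0 < μ := Real.log_pos ht1
  have hexp : Real.exp μ = t := Real.exp_log ht0
  have hcosh : Real.cosh μ = 1 / c := by
    rw [Real.cosh_eq, Real.exp_neg, hexp, ht]
    field_simp
    nlinarith
  have hsinh : Real.sinh μ = s / c := by
    rw [Real.sinh_eq, Real.exp_neg, hexp, ht]
    field_simp
    nlinarith
  -- termwise: `4 − 4c cos v = 4c (cosh μ − cos v)` with `v = 2πj/L + πτ/L`
  have hterm : ∀ j : ℕ, 1 / (4 - 4 * c * Real.cos (Real.pi * ((2 * j + τ : ℕ) : ℝ) / L))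
      = (1 / (4 * c)) * (1 / (Real.cosh μ - Real.cos (2 * Real.pi * (j : ℝ) / L + Real.pi * τ / L))) := by
    intro j
    have e : Real.pi * ((2 * j + τ : ℕ) : ℝ) / L = 2 * Real.pi * (j : ℝ) / L + Real.pi * τ / L := by
      push_cast; ring
    rw [e, hcosh]
    have hc' : c ≠ 0 := hc0.ne'
    rw [one_div_mul_one_div]
    congr 1
    field_simp
  rw [Finset.sum_congr rfl fun j _ => hterm j, ← Finset.mul_sum]
  rw [sum_range_eq_sum_zmod L (fun j => 1 / (Real.cosh μ - Real.cos (2 * Real.pi * (j : ℝ) / L + Real.pi * τ / L)))]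
  have hR := ringResolventSumShift_holds L μ hμ0 (Real.pi * τ / L)
  rw [hR]
  have hLφ : Real.cos (L * (Real.pi * τ / L)) = (-1) ^ τ := by
    rw [show (L : ℝ) * (Real.pi * τ / L) = τ * Real.pi by field_simp, Real.cos_nat_mul_pi]
  rw [hLφ, hsinh]
  have hc' : c ≠ 0 := hc0.ne'
  have hs' : s ≠ 0 := hs0.ne'
  have hden : Real.cosh (L * μ) - (-1) ^ τ ≠ 0 := by
    have h1 : 1 < Real.cosh ((L : ℝ) * μ) := Real.one_lt_cosh.mpr (by positivity)
    rcases neg_one_pow_eq_or ℝ τ with h | h <;> rw [h] <;> linarith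
  field_simp

/-- ★★ the inner ring sum is within `1/(2(1−c²))` of `L/(4√(1−c²))`, for `0 ≤ c < 1` and any `τ : ℕ`. [folklore] -/
theorem inner_sum_bound {c : ℝ} (hc0 : 0 ≤ c) (hc1 : c < 1) (τ : ℕ) :
    |∑ j ∈ Finset.range L, 1 / (4 - 4 * c * Real.cos (Real.pi * ((2 * j + τ : ℕ) : ℝ) / L))
        - L / (4 * Real.sqrt (1 - c ^ 2))| ≤ 1 / (2 * (1 - c ^ 2)) := by
  have hL0 : (0 : ℝ) < L := by exact_mod_cast Nat.pos_of_ne_zero (NeZero.ne L)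
  have hL1 : (1 : ℝ) ≤ L := by exact_mod_cast Nat.pos_of_ne_zero (NeZero.ne L)
  have h1c : 0 < 1 - c ^ 2 := by nlinarith
  rcases hc0.eq_or_lt with hc | hc
  · -- `c = 0`: the sum is `L/4` exactly
    rw [← hc]
    simp only [mul_zero, zero_mul, sub_zero, Finset.sum_const, Finset.card_range, nsmul_eq_mul,
      ne_eq, OfNat.ofNat_ne_zero, not_false_eq_true, zero_pow, Real.sqrt_one, mul_one]
    rw [show (L : ℝ) * (1 / 4) - L / 4 = 0 by ring, abs_zero]
    positivity
  · set s : ℝ := Real.sqrt (1 - c ^ 2) with hs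
    have hs0 : 0 < s := Real.sqrt_pos.mpr h1c
    have hs2 : s ^ 2 = 1 - c ^ 2 := Real.sq_sqrt h1c.le
    rw [inner_sum_closed L hc hc1 τ]
    set t : ℝ := (1 + s) / c with ht
    set X : ℝ := L * Real.log t with hX
    have ht1 : 1 < t := by rw [ht, lt_div_iff₀ hc]; linarith
    have ht0 : 0 < t := by linarith
    have hX0 : 0 < X := by rw [hX]; exact mul_pos hL0 (Real.log_pos ht1)
    have hT := abs_sinh_div_cosh_sub_pow_sub_one hX0 τ
    -- `exp X = t^L ≥ (1+s)^L ≥ 1 + L s`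
    have hexpX : Real.exp X = t ^ L := by
      rw [hX, Real.exp_nat_mul, Real.exp_log ht0]
    have hts : 1 + s ≤ t := by
      rw [ht, le_div_iff₀ hc]; nlinarith
    have hbern : 1 + (L : ℝ) * s ≤ Real.exp X := by
      rw [hexpX]
      calc 1 + (L : ℝ) * s ≤ (1 + s) ^ L := one_add_mul_le_pow (by linarith) L
        _ ≤ t ^ L := pow_le_pow_left₀ (by linarith) hts L
    have hT' : |Real.sinh X / (Real.cosh X - (-1) ^ τ) - 1| ≤ 2 / ((L : ℝ) * s) := by
      refine hT.trans ?_
      exact div_le_div_of_nonneg_left (by norm_num) (by positivity) (by linarith)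
    have e : (L : ℝ) / (4 * s) * (Real.sinh X / (Real.cosh X - (-1) ^ τ)) - L / (4 * s)
        = (L : ℝ) / (4 * s) * (Real.sinh X / (Real.cosh X - (-1) ^ τ) - 1) := by ring
    rw [e, abs_mul, abs_of_pos (by positivity : (0 : ℝ) < L / (4 * s)), ← hs2]
    calc (L : ℝ) / (4 * s) * |Real.sinh X / (Real.cosh X - (-1) ^ τ) - 1|
        ≤ (L : ℝ) / (4 * s) * (2 / ((L : ℝ) * s)) := mul_le_mul_of_nonneg_left hT' (by positivity)
      _ = 1 / (2 * s ^ 2) := by field_simp; ring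

/-! ## Odd sine sums -/

omit [NeZero L] in
/-- `2 sin u · Σ_{k<n} sin((2k+1)u) = 1 − cos(2nu)`. [folklore] -/
theorem two_sin_mul_sum_sin_odd (u : ℝ) (n : ℕ) :
    2 * Real.sin u * ∑ k ∈ Finset.range n, Real.sin ((2 * k + 1) * u) = 1 - Real.cos (2 * n * u) := by
  induction n with
  | zero => simp
  | succ n ih =>
    rw [Finset.sum_range_succ, mul_add, ih]
    have h := Real.cos_sub ((2 * n + 1) * u) u
    have h' := Real.cos_add ((2 * n + 1) * u) u
    push_cast
    have e1 : (2 * (n : ℝ) + 1) * u - u = 2 * n * u := by ring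
    have e2 : (2 * (n : ℝ) + 1) * u + u = 2 * (n + 1) * u := by ring
    rw [e1] at h
    rw [e2] at h'
    linarith

omit [NeZero L] in
/-- `2 sin(θ/2) · Σ_{p<N} sin(pθ) = cos(θ/2) − cos(Nθ − θ/2)`. [folklore] -/
theorem two_sin_half_mul_sum_sin (θ : ℝ) (N : ℕ) :
    2 * Real.sin (θ / 2) * ∑ p ∈ Finset.range N, Real.sin (p * θ) = Real.cos (θ / 2) - Real.cos (N * θ - θ / 2) := by
  induction N with
  | zero =>
    simp only [Finset.sum_range_zero, mul_zero, Nat.cast_zero, zero_mul, zero_sub, Real.cos_neg, sub_self]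
  | succ N ih =>
    rw [Finset.sum_range_succ, mul_add, ih]
    have h := Real.cos_sub (N * θ) (θ / 2)
    have h' := Real.cos_add (N * θ) (θ / 2)
    push_cast
    have e2 : (N : ℝ) * θ + θ / 2 = (N + 1) * θ - θ / 2 := by ring
    rw [e2] at h'
    linarith

omit [NeZero L] in
/-- ★ `Σ_{p<L} sin(p·(2k+1)π/L) = cos θ / sin θ` with `θ = (2k+1)π/(2L)`, for `2k + 1 < 2L` (`L ≥ 1`). [folklore] -/
theorem sum_sin_odd_eq_cot (L k : ℕ) (hL : 1 ≤ L) (hk : 2 * k + 1 < 2 * L) :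
    ∑ p ∈ Finset.range L, Real.sin (p * ((2 * k + 1) * Real.pi / L))
      = Real.cos ((2 * k + 1) * Real.pi / (2 * L)) / Real.sin ((2 * k + 1) * Real.pi / (2 * L)) := by
  have hL0 : (0 : ℝ) < L := by exact_mod_cast (show 0 < L by omega)
  set θ : ℝ := (2 * k + 1) * Real.pi / L with hθ
  have hhalf : θ / 2 = (2 * k + 1) * Real.pi / (2 * L) := by rw [hθ]; field_simp
  have h := two_sin_half_mul_sum_sin θ L
  have hLθ : (L : ℝ) * θ - θ / 2 = ((2 * k + 1 : ℕ) : ℝ) * Real.pi - θ / 2 := by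
    rw [hθ]; push_cast; field_simp
  rw [hLθ, Real.cos_nat_mul_pi_sub, pow_succ, pow_mul, neg_one_sq, one_pow, one_mul, neg_one_mul,
    sub_neg_eq_add, hhalf] at h
  rw [← hhalf] at h ⊢
  -- `sin(θ/2) > 0`
  have hpos : 0 < Real.sin (θ / 2) := by
    apply Real.sin_pos_of_pos_of_lt_pi
    · rw [hθ]; positivity
    · rw [hhalf, div_lt_iff₀ (by positivity)]
      have : ((2 * k + 1 : ℕ) : ℝ) < ((2 * L : ℕ) : ℝ) := by exact_mod_cast hk
      push_cast at this
      nlinarith [Real.pi_pos]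
  rw [eq_div_iff hpos.ne']
  linarith

omit [NeZero L] in
/-- `|θ·cos θ/sin θ − 1| ≤ θ²/2` for `0 < θ < π/2`. [folklore] -/
theorem abs_theta_cot_sub_one_le {θ : ℝ} (h0 : 0 < θ) (h1 : θ < Real.pi / 2) :
    |θ * Real.cos θ / Real.sin θ - 1| ≤ θ ^ 2 / 2 := by
  have hsin : 0 < Real.sin θ := Real.sin_pos_of_pos_of_lt_pi h0 (by linarith [Real.pi_pos])
  have hcos : 0 < Real.cos θ := Real.cos_pos_of_mem_Ioo ⟨by linarith, h1⟩
  have htan := Real.le_tan h0.le h1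
  rw [Real.tan_eq_sin_div_cos, le_div_iff₀ hcos] at htan
  have hsl := Real.sin_le h0.le
  have hcl := Real.one_sub_sq_div_two_le_cos (x := θ)
  rw [abs_le]
  constructor
  · -- lower: `θ cos θ / sin θ ≥ 1 − θ²/2`
    rw [le_sub_iff_add_le, le_div_iff₀ hsin]
    by_cases hθ2 : 0 ≤ 1 - θ ^ 2 / 2
    · have := mul_le_mul hcl hsl hsin.le hcos.le
      linarith
    · have hθ2' : 1 - θ ^ 2 / 2 < 0 := lt_of_not_ge hθ2
      nlinarith [mul_pos h0 hcos, mul_neg_of_neg_of_pos hθ2' hsin]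
  · rw [sub_le_iff_le_add, div_le_iff₀ hsin]
    nlinarith

end Summit.HubbardSuperconductivity.HubbardSuperconductivity.Theorems.AnisotropyChord.Transfer.Fibre3

end
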